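import Summits.ResolutionOfSingularities.ResolutionOfSingularities.Theorems.EquisingularLiftEquisingularLiftNatTowerBFourPointSteps
import Summits.ResolutionOfSingularities.ResolutionOfSingularities.Theorems.EquisingularLiftEquisingularLiftNatTowerBPointStepsFE
import Summits.ResolutionOfSingularities.ResolutionOfSingularities.Theorems.EquisingularLiftEquisingularLiftNatTowerRoundBTriplePrimeDefs
import HarnessLib

/-!
# [OURS · L1 W4.5(b) · EL♮(3) · T23-A‴] THE POINT-STEP CLOSURES OF THE B‴-TOWER ON THE ENGINE INVARIANT AT THE DATUM «`V(𝓔)` IS `O`-FLAT»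
# — `TowerPtRegB₄` / `TowerPtRamB₄` on `INV₁‴ := (Tower.InvB₄ FE … ∧ K-side facts) ∧ hcar ∧ IsLocallyNoetherian F₉`

res-L1-w45b-stub-4 g11 (T23-A‴ engine owner; engine word v1.2 FINAL `L/res-L1-w45b-stub-4/T23Atriple-ENGINE-WORD-v1.md` d02b1fbd6b6fb5d2, desk R28).
Crux EL♮(3) = stmt-ResolutionOfSingularities-20148 (parent stmt-…-20038). OURS; NOT a statement of any manuscript ([Hironaka2017] is a candidate under
adjudication, nothing of it is asserted); AI-written, weaker than expert review. DEF-FREE; no `sorry`; standard axioms. `--supports stmt-…-20148 --as helper`.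

WHAT. The `(pt-reg)` / `(pt-ram)` arms of the assembly V10⁗ as standalone theorems: the step predicates `TowerPtRegB₄ F₁₀ R` / `TowerPtRamB₄ F₁₀ R`
(res-L1-w45b-lead-2 `…NatTowerRoundBTriplePrimeDefs`, text = my SIG 63338a4ddb1b01c8) hold for `R := INV₁‴` — three-line wrappers over res-type-027's
`Tower.invB₄_ptRegStep` / `Tower.invB₄_ptRamStep` (p625638; at `FE` the stand-ins are `Tower.feIsoC` and `fun … h => h`) plus the K-side facts
(`K' = ∅`, or `St K` off the point against the new plane / `St E` / — the SWITCH arm — with `K' = ∅`, contradiction-free by `rw [hK0]`), exactly as my B twins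
`Tower.towerPtRegB_invB₁_FE` / `Tower.towerPtRamB_invB₁_FE` (…NatTowerBPointStepsFE p619596). [cite: Liu2002, §8.1 and Thm. 8.1.19]
-/

set_option linter.dupNamespace false -- mandated namespace `Summit.<Summit>.<Problem>` of this single-conjunct summit
set_option linter.overlappingInstances false -- signatures carry `[IsDomain O] [IsDiscreteValuationRing O]`

noncomputable section

open CategoryTheory CategoryTheory.Limits AlgebraicGeometry TopologicalSpace Topology IsLocalRing
open Literature.AlgebraicGeometry.Resolution
open AlgebraicGeometry.Scheme.IdealSheafData
open Summit.ResolutionOfSingularities.ResolutionOfSingularities.Theses.EquisingularLift.Split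

namespace Summit.ResolutionOfSingularities.ResolutionOfSingularities.Cruxes.EquisingularLiftNat.Sections

/-! ## The point-step closures on `INV₁‴ := (Tower.InvB₄ FE … ∧ K-side facts) ∧ hcar ∧ IsLocallyNoetherian F₉` -/

section PtFE4

variable (O : Type) [CommRing O] [IsDomain O] [IsDiscreteValuationRing O] [IsAdicComplete (IsLocalRing.maximalIdeal O) O]
    [IsAlgClosed (IsLocalRing.ResidueField O)] (k : Type) [Field k]
    (θ : O →+* k) (hθ : Function.Surjective θ)
    (P : Scheme.{0}) [IsIntegral P] (q : P ⟶ Spec (.of O)) [IsProper q] [SmoothOfRelativeDimension 3 q] (Y : Set P)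
    (hYsp : Y ⊆ q ⁻¹' {IsLocalRing.closedPoint O}) (hYirr : IsIrreducible Y) (hYcl : IsClosed Y)
    (hPnoeth : IsLocallyNoetherian P) (hPreg : Scheme.IsRegular P)
    (Ch : ∀ X' : Scheme.{0}, (X' ⟶ P) → Set X' → Prop)
    (hChStep : ∀ (X' X'' : Scheme.{0}) (σ' : X' ⟶ P) (S' : Set X') (C : X'.IdealSheafData) (τ : X'' ⟶ X'),
      Ch X' σ' S' → IsBlowup τ C → Scheme.IsRegular C.subscheme → Flat (C.subschemeι ≫ σ' ≫ q) →
      σ' '' (C.support : Set X') ⊆ {y | ¬ IsGenericPoint y Y} → (C.support : Set X') ∩ (σ' ≫ q) ⁻¹' {IsLocalRing.closedPoint O} ⊆ S' →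
      Ch X'' (τ ≫ σ') (closure (τ ⁻¹' (S' \ (C.support : Set X')))))
    (hChSplit : ∀ (X' : Scheme.{0}) (σ' : X' ⟶ P) (S' : Set X'), Ch X' σ' S' → Chain P Y X' σ' S')

include hθ hYsp hYirr hYcl hPnoeth hPreg hChStep hChSplit

omit [IsIntegral P] [SmoothOfRelativeDimension 3 q] in
/-- **`(pt-reg)‴` on the engine invariant `INV₁‴` at `FE`**: a wrapper over res-type-027's `Tower.invB₄_ptRegStep` (p625638) plus the K-side facts.
[OURS · L1 W4.5b · T23-A‴ engine] toward the A‴ rung; NOT a statement of the manuscript. -/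
theorem Tower.towerPtRegB₄_invB₁_FE :
    ∀ (F₉ : Scheme.{0}) (Z₉ : Set F₉) (hZ₉ : IsClosed Z₉) (F₁₀ : Scheme.{0}) (υ' : F₁₀ ⟶ F₉),
      TowerPtRegB₄ F₁₀ (fun G γ T E Es Ns K =>
        (Tower.InvB₄ O k θ P q Y Ch (fun _ _ _ _ _ _ _ _ _ σ _ 𝓔 => Flat (𝓔.subschemeι ≫ σ ≫ q)) F₉ Z₉ hZ₉ F₁₀ υ' G γ T E Es Ns K ∧
          IsClosed K ∧ K ⊆ closure (K \ E) ∧ K ≠ Set.univ) ∧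
        (∀ z : ↥(redSub F₉ Z₉ hZ₉), IsClosed ({z} : Set ↥(redSub F₉ Z₉ hZ₉)) →
          ringKrullDim ((redSub F₉ Z₉ hZ₉).presheaf.stalk z) = ((1 : ℕ) : WithBot ℕ∞)) ∧ IsLocallyNoetherian F₉) := by
  intro F₉ Z₉ hZ₉ F₁₀ υ' G G' γ T E Es Ns K y υ₂ hy K' E' Es' Ns' hinv hTreg hGreg hυ₂ hK' hE' hEs' hNs'
  obtain ⟨⟨hinv, hKcl, hKE, hKne⟩, hcar, hF₉noeth⟩ := hinv
  have hI₂ := Tower.invB₄_ptRegStep O k θ hθ P q Y hYsp hYirr hYcl hPnoeth hPreg Ch hChSplit hChStep _ F₉ Z₉ hZ₉ F₁₀ υ'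
    (Tower.feIsoC O P q Z₉ hZ₉ υ') (fun _ _ _ _ _ _ _ _ _ _ _ h => h) G G' γ T E Es Ns K y υ₂ hy K' E' Es' Ns' hinv hTreg hGreg hυ₂ hK' hE' hEs' hNs'
  refine (fun h3 => ⟨⟨hI₂, h3⟩, hcar, hF₉noeth⟩) ?_
  obtain ⟨-, -, hGint, -, hTirr, hEcl, hTE, hEsB, -⟩ := hinv
  obtain ⟨-, -, hG'int, -⟩ := hI₂
  haveI := hGint
  haveI := hG'int
  have hTy : ¬ T ⊆ {curvePt G T y} := not_subset_singleton_of_not_isRegularLocalRing_stalk y hTreg hy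
  have hDsupp : ((vanishingIdeal (⟨{curvePt G T y}, hy⟩ : Closeds G) : G.IdealSheafData).support : Set G) = {curvePt G T y} :=
    Scheme.IdealSheafData.coe_support_vanishingIdeal _
  rcases hK' with rfl | ⟨hyK, rfl⟩
  · exact ⟨isClosed_empty, by simp, Set.empty_ne_univ⟩
  · refine ⟨isClosed_closure, ?_, closure_preimage_ne_univ υ₂ _ hυ₂ K {curvePt G T y} hKcl hKne hy
      (fun h => hTy (h ▸ Set.subset_univ _)) hDsupp.le _ (Set.preimage_mono fun z hz => hz.1)⟩
    rcases hE' with rfl | ⟨-, rfl⟩ | ⟨F, -, -, -, hK0⟩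
    · exact closure_preimage_diff_subset_closure_diff_preimage υ₂ K {curvePt G T y}
    · have h := closure_preimage_diff_subset_of_isBlowup υ₂ (vanishingIdeal (⟨{curvePt G T y}, hy⟩ : Closeds G)) hυ₂ K E hEcl hKE
      rw [hDsupp] at h
      exact h
    · rw [hK0]; exact Set.empty_subset _


/-- **`(pt-ram)‴` on the engine invariant `INV₁‴` at `FE`**: a wrapper over res-type-027's `Tower.invB₄_ptRamStep` (p625638) plus the K-side facts.
[OURS · L1 W4.5b · T23-A‴ engine] toward the A‴ rung; NOT a statement of the manuscript. -/
theorem Tower.towerPtRamB₄_invB₁_FE :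
    ∀ (F₉ : Scheme.{0}) (Z₉ : Set F₉) (hZ₉ : IsClosed Z₉) (F₁₀ : Scheme.{0}) (υ' : F₁₀ ⟶ F₉),
      TowerPtRamB₄ F₁₀ (fun G γ T E Es Ns K =>
        (Tower.InvB₄ O k θ P q Y Ch (fun _ _ _ _ _ _ _ _ _ σ _ 𝓔 => Flat (𝓔.subschemeι ≫ σ ≫ q)) F₉ Z₉ hZ₉ F₁₀ υ' G γ T E Es Ns K ∧
          IsClosed K ∧ K ⊆ closure (K \ E) ∧ K ≠ Set.univ) ∧
        (∀ z : ↥(redSub F₉ Z₉ hZ₉), IsClosed ({z} : Set ↥(redSub F₉ Z₉ hZ₉)) →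
          ringKrullDim ((redSub F₉ Z₉ hZ₉).presheaf.stalk z) = ((1 : ℕ) : WithBot ℕ∞)) ∧ IsLocallyNoetherian F₉) := by
  intro F₉ Z₉ hZ₉ F₁₀ υ' G G' γ T E Es Ns K y J υ₂ K' E' Es' Ns' hinv hTreg _hGreg hJsupp hJgen hυ₂ hK' hE' hEs' hNs'
  obtain ⟨⟨hinv, hKcl, hKE, hKne⟩, hcar, hF₉noeth⟩ := hinv
  have hI₂ := Tower.invB₄_ptRamStep O k θ hθ P q Y hYsp hYirr hYcl hPnoeth hPreg Ch hChSplit hChStep _ F₉ Z₉ hZ₉ F₁₀ υ'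
    (Tower.feIsoC O P q Z₉ hZ₉ υ') G G' γ T E Es Ns K y J υ₂ K' E' Es' Ns' hinv hTreg hJsupp hJgen hυ₂ hK' hE' hEs' hNs'
  refine (fun h3 => ⟨⟨hI₂, h3⟩, hcar, hF₉noeth⟩) ?_
  obtain ⟨-, -, hGint, -, hTirr, hEcl, hTE, hEsB, -⟩ := hinv
  obtain ⟨-, -, hG'int, -⟩ := hI₂
  haveI := hGint
  haveI := hG'int
  have hyc : IsClosed ({curvePt G T y} : Set G) := hJsupp ▸ J.support.isClosed
  have hTy : ¬ T ⊆ {curvePt G T y} := not_subset_singleton_of_not_isRegularLocalRing_stalk y hTreg hyc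
  rcases hK' with rfl | ⟨hyK, rfl⟩
  · exact ⟨isClosed_empty, by simp, Set.empty_ne_univ⟩
  · refine ⟨isClosed_closure, ?_, closure_preimage_ne_univ υ₂ _ hυ₂ K {curvePt G T y} hKcl hKne hyc
      (fun h => hTy (h ▸ Set.subset_univ _)) hJsupp.le _ (Set.preimage_mono fun z hz => hz.1)⟩
    rcases hE' with ⟨-, rfl⟩ | ⟨F, -, -, -, hK0⟩
    · have h := closure_preimage_diff_subset_of_isBlowup υ₂ J hυ₂ K E hEcl hKE
      rw [hJsupp] at h
      exact h
    · rw [hK0]; exact Set.empty_subset _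

end PtFE4

end Summit.ResolutionOfSingularities.ResolutionOfSingularities.Cruxes.EquisingularLiftNat.Sections

end
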